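import Summits.CriticalPhenomena.Ising3DConformalLimit.Theses.HelsonAxis
import Summits.CriticalPhenomena.Ising3DConformalLimit.Theorems.InverseSquareTelemetryTwoPointSpineComplementSplit
import HarnessLib

/-!
# The shared crux `TwoPointSpineComplement` (item stmt-CriticalPhenomena-4497) read from route `HelsonAxis`
# (lead c4; `--supports stmt-CriticalPhenomena-4497`)

THEOREM-ONLY helper file (no definition, no named fact, no `sorry`). Route `HelsonAxis` (opened 2026-08-17T09:27Z) wants the
same item stmt-4497 as route `InverseSquareTelemetry`; its decl `Theses.HelsonAxis.TwoPointSpineComplement` is byte-identical to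
`Theses.InverseSquareTelemetry.TwoPointSpineComplement`, so the two are definitionally equal and every landed theorem about the
InverseSquareTelemetry copy transfers by `Iff.rfl`. Recorded here BY NAME for the HelsonAxis planners / assembly:

* `twoPointSpineComplement_iff_inverseSquareTelemetry` — the two copies coincide;
* `helsonAxis_TwoPointSpineComplement_of_subs` — the exact split glue 4738 → 1982 → 0636 → (C) (`Split.TwoPointSpineComplement_of_subs`,
  p150831) concluding the HelsonAxis copy;
* `twoPointSpineComplement_iff_subs` — exactness `(C) ↔ (0634 → 4738 ∧ 1982 ∧ 0636)` for the HelsonAxis copy;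
* `twoPointSpineComplement_iff_conjunct_of_law` — `(C) ↔ (0634 → Ising3DConformalLimit)`: on HelsonAxis the three upstream
  items (cone, η-bounds, forcing, axis-to-isotropic) produce exactly a witness of 0634, after which (C) IS the conjunct.

Nothing here is new mathematics (Duminil-Copin, ICM 2022, §8.4: existence, conformal covariance and non-Gaussianity of the
critical `ℤ³` scaling limit are open).
-/

noncomputable section

namespace Summit.CriticalPhenomena.Ising3DConformalLimit.HelsonAxisTwoPointSpineComplement.Shared

open Summit.CriticalPhenomena.Ising3DConformalLimit.Theses
open Summit.CriticalPhenomena.Ising3DConformalLimit.InverseSquareTelemetryTwoPointSpineComplement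

/-- The HelsonAxis copy and the InverseSquareTelemetry copy of the shared crux (item stmt-4497) are the same
proposition (byte-identical route decls). [folklore] -/
theorem twoPointSpineComplement_iff_inverseSquareTelemetry :
    HelsonAxis.TwoPointSpineComplement ↔ InverseSquareTelemetry.TwoPointSpineComplement :=
  Iff.rfl

/-- **Split glue for the HelsonAxis copy (header on one line).** Items 4738 (`WeylWindow.LimitExists`) → 1982
(`HyperoctahedralRP.InversionUpgradeNormalised`) → 0636 (`PrecisionLaplacian.IsingEuclidUpgradeR4NonGaussian`) → (C), by the
landed `Split.TwoPointSpineComplement_of_subs` (p150831). [cite: DuminilCopinICM2022, §8.4 p. 29] -/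
theorem helsonAxis_TwoPointSpineComplement_of_subs : Summit.CriticalPhenomena.Ising3DConformalLimit.Theses.WeylWindow.LimitExists → Summit.CriticalPhenomena.Ising3DConformalLimit.Theses.HyperoctahedralRP.InversionUpgradeNormalised → Summit.CriticalPhenomena.Ising3DConformalLimit.Theses.PrecisionLaplacian.IsingEuclidUpgradeR4NonGaussian → Summit.CriticalPhenomena.Ising3DConformalLimit.Theses.HelsonAxis.TwoPointSpineComplement :=
  Split.TwoPointSpineComplement_of_subs

/-- **Exactness of the split for the HelsonAxis copy: (C) ↔ (item 0634 → items 4738 ∧ 1982 ∧ 0636)**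
(`Split.twoPointSpineComplement_iff_subs`, p150831). [cite: DuminilCopinICM2022, §8.4 p. 29] -/
theorem twoPointSpineComplement_iff_subs :
    HelsonAxis.TwoPointSpineComplement ↔
      (InverseSquareTelemetry.IsingEuclidUpgradeR2RotInvPowerLaw →
        WeylWindow.LimitExists ∧ HyperoctahedralRP.InversionUpgradeNormalised ∧
          PrecisionLaplacian.IsingEuclidUpgradeR4NonGaussian) :=
  Split.twoPointSpineComplement_iff_subs

/-- **(C) ↔ (item 0634 → the conjunct)** for the HelsonAxis copy (`Anatomy.twoPointSpineComplement_iff_conjunct_of_law`,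
p146538): once `AxisToIsotropicLaw` has produced the isotropic cofinite law (a witness of item 0634), the shared crux is
literally the sub-problem `Ising3DConformalLimit`. [cite: DuminilCopinICM2022, §8.4 p. 29] -/
theorem twoPointSpineComplement_iff_conjunct_of_law :
    HelsonAxis.TwoPointSpineComplement ↔
      (InverseSquareTelemetry.IsingEuclidUpgradeR2RotInvPowerLaw → _root_.Ising3DConformalLimit) :=
  Anatomy.twoPointSpineComplement_iff_conjunct_of_law

/-- The isotropic cofinite law in the form produced on route HelsonAxis (`∃ Δ c, 0 < c ∧ Tendsto …`, the conclusion of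
`AxisToIsotropicLaw`) IS a witness of item 0634 `IsingEuclidUpgradeR2RotInvPowerLaw`; with it the shared crux gives the
conjunct. [folklore] -/
theorem ising3DConformalLimit_of_isotropicLaw (h : HelsonAxis.TwoPointSpineComplement)
    (hlaw : ∃ Δ c : ℝ, 0 < c ∧ Filter.Tendsto (fun x : Literature.Probability.LatticeModels.Site 3 =>
      Literature.Probability.LatticeModels.criticalTwoPoint 3 x * Real.sqrt (∑ i, ((x i : ℝ)) ^ 2) ^ (2 * Δ))
        Filter.cofinite (nhds c)) :
    _root_.Ising3DConformalLimit := by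
  obtain ⟨Δ, c, hc, hP⟩ := hlaw
  exact Anatomy.ising3DConformalLimit_of_twoPointSpineComplement h ⟨Δ, c, hc, hP⟩

end Summit.CriticalPhenomena.Ising3DConformalLimit.HelsonAxisTwoPointSpineComplement.Shared

end
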